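import Summits.ResolutionOfSingularities.KangarooAtlas.MizutaniSchemeDimension
import Literature.AlgebraicGeometry.Resolution.HironakaGroupSchemeMultiplicity
import HarnessLib

/-!
# Mizutani's conjecture — the dimension of Hironaka's `B_{P,𝔭} = Spec(S/U_+(𝔭)S)` (Mizutani Thm. 1.3, Hironaka's side)

Cell topic `Summits/ResolutionOfSingularities/KangarooAtlas` (pub-rosobs); namespace
`Summit.ResolutionOfSingularities.KangarooAtlas.Mizutani`.  Companion of `MizutaniSchemeDimension.lean` (Oda's side:
`ringKrullDim (S ⧸ schemeIdeal k p 𝔭) = hsDim k p 𝔭`).  AI-written; *AI review is weaker than expert review*; NOT a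
resolution theorem, NOT summit progress.  The tree now holds TWO vocabularies for Hironaka's additive group scheme of
a point `𝔭` of `ℙ^n_k`: Oda's coefficient description (`invForms` / `hsDimAt`, `HironakaGroupScheme.lean`, used by
the whole Mizutani chain) and Hironaka's/Mizutani's MULTIPLICITY description (`HironakaScheme.multAlgebra k 𝔭 = U(𝔭)`,
`HironakaScheme.bIdeal k 𝔭 = U_+(𝔭)S`, "`dim B_{P,𝔭}` := `ringKrullDim (S ⧸ bIdeal k 𝔭)`",
`HironakaGroupSchemeMultiplicity.lean`; `hirForms k p 𝔭 e = U(𝔭) ∩ L_e` on coefficient vectors,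
`MizutaniMultiplicity.lean`).  This file proves, for a point `𝔭`:

* `homogeneousComponent_mem_symbPow_of_mem_multAlgebra` — `U(𝔭)` is GRADED with `U_d ⊆ 𝔭^{(d)}`: every
  homogeneous component of degree `d` of an element of `U(𝔭)` has multiplicity `≥ d` (so
  `mem_hirForms_of_addForm_mem_multAlgebra`: an additive form lies in `U(𝔭)` iff its coefficient vector lies in
  `hirForms`);
* `famIdeal_hirForms_le_bIdeal` — the additive forms of `U(𝔭)` lie in `U_+(𝔭)S` (unconditional);
* **`bIdeal_eq_famIdeal_hirForms`** — under Hironaka's theorem "`U(𝔭)` is generated by additive forms" (the named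
  fact `HironakaScheme.Hironaka1970_thm1_cor`, [Hironaka 1970 Kyoto (13.2)], [Hironaka 1970 Ann. Th. 1 Cor.],
  printed proof Dietel 2015 Lemma (9.1.4)), `U_+(𝔭)S` is the ideal generated by the additive forms of `U(𝔭)`;
* **`ringKrullDim_quotient_bIdeal`** — hence MIZUTANI'S THEOREM 1.3 on Hironaka's side:
  `dim B_{P,𝔭} = ringKrullDim (S ⧸ U_+(𝔭)S) = (n+1) − dim_k (U(𝔭) ∩ L)_{e₀}` for every level `e₀` from which on
  `U(𝔭) ∩ L` is generated (conditional on `Hironaka1970_thm1_cor` only);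
* **`ringKrullDim_quotient_bIdeal_eq_hsDim`** — and under Oda's equality `U(𝔭) ∩ L_e = (L_B)_e` (Oda 1973 Prop. 2.2
  (ii), displayed hypothesis as in `MizutaniMultiplicityBridge.lean`) the two vocabularies' dimensions agree:
  `ringKrullDim (S ⧸ bIdeal k 𝔭) = hsDim k p 𝔭`, so that Mizutani's bound reads
  `2·p^{exponent} ≤ dim B_{P,𝔭} + 1` (`two_mul_pow_exponent_le_ringKrullDim_bIdeal_succ`).

References: [Mizutani1973HironakaGroupSchemes] Def. 1.1, §1 (c), Thm. 1.3; [Hironaka1970NumericalCharacters] (13.2);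
[Oda1983HironakaGroupSchemeII] §2 (p. 1168); [Dietel2015] Lemma (9.1.4).
-/

open MvPolynomial Literature.AlgebraicGeometry.Resolution Literature.AlgebraicGeometry.Resolution.HironakaScheme

namespace Summit.ResolutionOfSingularities.KangarooAtlas.Mizutani

universe u

section Graded

variable {k : Type u} [Field k] {σ : Type*} {𝔭 : Ideal (MvPolynomial σ k)}

/-- `0` has multiplicity `≥ d` for every `d` (at a proper `𝔭`). [folklore] -/
theorem zero_mem_symbPow (h𝔭 : 𝔭 ≠ ⊤) (d : ℕ) : (0 : MvPolynomial σ k) ∈ symbPow k 𝔭 d :=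
  ⟨1, fun h => h𝔭 ((Ideal.eq_top_iff_one 𝔭).mpr h), by rw [mul_zero]; exact Ideal.zero_mem _⟩

/-- `𝔭^{(d)}` is closed under addition (for `𝔭` prime). [folklore] -/
theorem add_mem_symbPow [h𝔭 : 𝔭.IsPrime] {d : ℕ} {f g : MvPolynomial σ k} (hf : f ∈ symbPow k 𝔭 d)
    (hg : g ∈ symbPow k 𝔭 d) : f + g ∈ symbPow k 𝔭 d := by
  obtain ⟨s, hs, hsf⟩ := hf
  obtain ⟨t, ht, htg⟩ := hg
  refine ⟨s * t, fun h => (h𝔭.mem_or_mem h).elim hs ht, ?_⟩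
  rw [mul_add, show s * t * f = t * (s * f) by ring, mul_assoc]
  exact Ideal.add_mem _ (Ideal.mul_mem_left _ _ hsf) (Ideal.mul_mem_left _ _ htg)

/-- `𝔭^{(d)}` is closed under ring multiples: `c f ∈ 𝔭^{(d)}` for `f ∈ 𝔭^{(d)}`. [folklore] -/
theorem mul_mem_symbPow_left {d : ℕ} (c : MvPolynomial σ k) {f : MvPolynomial σ k} (hf : f ∈ symbPow k 𝔭 d) :
    c * f ∈ symbPow k 𝔭 d := by
  obtain ⟨s, hs, hsf⟩ := hf
  refine ⟨s, hs, ?_⟩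
  rw [mul_left_comm]
  exact Ideal.mul_mem_left _ _ hsf

/-- **`U(𝔭)` is graded with `U_d ⊆ 𝔭^{(d)}`**: the degree-`d` homogeneous component of every element of
`U(𝔭) = k[multGens]` has multiplicity `≥ d` at `𝔭` (elements of `U(𝔭)` are `k`-linear combinations of products of
homogeneous generators, and such products are again homogeneous generators).
[cite: Mizutani1973HironakaGroupSchemes, p. 85 L21–25 (U(p) = Σ_m U_m(p), U_m(p) = {f ∈ S_m : mult_p ≥ m})] -/
theorem homogeneousComponent_mem_symbPow_of_mem_multAlgebra [h𝔭 : 𝔭.IsPrime] {u : MvPolynomial σ k}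
    (hu : u ∈ multAlgebra k 𝔭) (d : ℕ) : homogeneousComponent d u ∈ symbPow k 𝔭 d := by
  classical
  -- products of homogeneous generators are homogeneous generators (`mul_mem_multGens`), and so is `1`
  have hcl : (Submonoid.closure (multGens k 𝔭) : Set (MvPolynomial σ k)) ⊆ multGens k 𝔭 := by
    intro φ hφ
    induction hφ using Submonoid.closure_induction with
    | mem ψ hψ => exact hψ
    | one => exact ⟨0, isHomogeneous_one σ k, mem_symbPow_zero h𝔭.ne_top 1⟩
    | mul ψ₁ ψ₂ _ _ h₁ h₂ => exact mul_mem_multGens h₁ h₂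
  have hu' : u ∈ Submodule.span k (Submonoid.closure (multGens k 𝔭) : Set (MvPolynomial σ k)) := by
    rw [← Algebra.adjoin_eq_span]
    exact hu
  refine Submodule.span_induction ?_ ?_ ?_ ?_ hu'
  · intro φ hφ
    obtain ⟨d₀, hφd₀, hφs⟩ := hcl hφ
    rw [homogeneousComponent_of_mem (m := d) ((mem_homogeneousSubmodule d₀ φ).mpr hφd₀)]
    split_ifs with h
    · subst h; exact hφs
    · exact zero_mem_symbPow h𝔭.ne_top d
  · rw [map_zero]; exact zero_mem_symbPow h𝔭.ne_top d
  · intro f g _ _ hf hg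
    rw [map_add]; exact add_mem_symbPow hf hg
  · intro c f _ hf
    rw [map_smul, MvPolynomial.smul_eq_C_mul]
    exact mul_mem_symbPow_left _ hf

end Graded

section Hironaka

variable (k : Type u) [Field k] (p : ℕ) [hp : Fact p.Prime] [CharP k p] {n : ℕ}
  (𝔭 : Ideal (MvPolynomial (Fin (n + 1)) k))

omit hp [CharP k p] in
/-- An additive form `Σ_j a_j X_j^{p^e}` is homogeneous of degree `p^e`. [cite: Oda1983HironakaGroupSchemeII, §2 (p. 1167: L_e ⊂ S_{p^e})] -/
theorem isHomogeneous_addForm (e : ℕ) (a : Fin (n + 1) → k) : (addForm k p e a).IsHomogeneous (p ^ e) := by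
  unfold addForm
  refine IsHomogeneous.sum _ _ _ fun j _ => ?_
  exact (isHomogeneous_X_pow j (p ^ e)).C_mul (a j)

omit [CharP k p] in
/-- An additive form has zero constant term. [folklore] -/
theorem constantCoeff_addForm_eq_zero (e : ℕ) (a : Fin (n + 1) → k) : constantCoeff (addForm k p e a) = 0 := by
  have h := (isHomogeneous_addForm k p e a).coeff_eq_zero (d := 0) (by
    rw [map_zero]; exact (pow_pos hp.out.pos e).ne)
  rw [constantCoeff_eq]
  exact h

omit hp [CharP k p] in
/-- The additive form of a vector of `hirForms k p 𝔭 e = U(𝔭) ∩ L_e` is a homogeneous generator of `U(𝔭)`.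
[cite: Mizutani1973HironakaGroupSchemes, Def. 1.1 and §1 (c)] -/
theorem addForm_mem_multGens [𝔭.IsPrime] {e : ℕ} {a : Fin (n + 1) → k} (ha : a ∈ hirForms k p 𝔭 e) :
    addForm k p e a ∈ multGens k 𝔭 :=
  ⟨p ^ e, isHomogeneous_addForm k p e a, mem_hirForms_iff.mp ha⟩

omit hp [CharP k p] in
/-- **An additive form lies in `U(𝔭)` iff its coefficient vector lies in `hirForms`** (`⇐`: it is a generator;
`⇒`: its degree-`p^e` component is itself, and `U_{p^e} ⊆ 𝔭^{(p^e)}`). [cite: Mizutani1973HironakaGroupSchemes, §1 (c) (U(𝔭) ∩ L)] -/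
theorem addForm_mem_multAlgebra_iff [𝔭.IsPrime] {e : ℕ} {a : Fin (n + 1) → k} :
    addForm k p e a ∈ multAlgebra k 𝔭 ↔ a ∈ hirForms k p 𝔭 e := by
  constructor
  · intro h
    have hc := homogeneousComponent_mem_symbPow_of_mem_multAlgebra h (p ^ e)
    rw [homogeneousComponent_of_mem (m := p ^ e)
      ((mem_homogeneousSubmodule (p ^ e) _).mpr (isHomogeneous_addForm k p e a)), if_pos rfl] at hc
    exact mem_hirForms_iff.mpr hc
  · intro ha
    exact Algebra.subset_adjoin (addForm_mem_multGens k p 𝔭 ha)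

omit [CharP k p] in
/-- **The additive forms of `U(𝔭)` lie in `U_+(𝔭)S`**: `famIdeal (hirForms) ≤ bIdeal` (unconditional).
[cite: Mizutani1973HironakaGroupSchemes, Def. 1.1 (U_+(p)S)] -/
theorem famIdeal_hirForms_le_bIdeal [𝔭.IsPrime] : famIdeal k p (hirForms k p 𝔭) ≤ bIdeal k 𝔭 := by
  unfold famIdeal bIdeal
  refine Ideal.span_mono ?_
  rintro _ ⟨_, ⟨e, rfl⟩, ⟨a, ha, rfl⟩⟩
  exact ⟨(addForm_mem_multAlgebra_iff k p 𝔭).mpr ha, constantCoeff_addForm_eq_zero k p e a⟩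

/-- **`U_+(𝔭)S` is generated by the additive forms of `U(𝔭)`**, given Hironaka's theorem that `U(𝔭)` is generated
as a `k`-algebra by additive forms (the named fact `Hironaka1970_thm1_cor`; Mizutani Def. 1.1 with p. 85 L26–28).
[cite: Mizutani1973HironakaGroupSchemes, p. 85 L26–28 and Def. 1.1; Hironaka1970NumericalCharacters, (13.2) p. 168] -/
theorem bIdeal_eq_famIdeal_hirForms (hH : Hironaka1970_thm1_cor.{u} p) (hP : IsPoint k 𝔭) [𝔭.IsPrime] :
    bIdeal k 𝔭 = famIdeal k p (hirForms k p 𝔭) := by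
  refine le_antisymm ?_ (famIdeal_hirForms_le_bIdeal k p 𝔭)
  unfold bIdeal
  rw [Ideal.span_le]
  rintro f ⟨hfU, hf0⟩
  have hU := hH k n 𝔭 hP
  have hfU' : f ∈ Algebra.adjoin k
      {g | g ∈ multAlgebra k 𝔭 ∧ ∃ (e : ℕ) (a : Fin (n + 1) → k), g = addForm k p e a} := by
    rw [← hU]; exact hfU
  have hG : ∀ g ∈ {g | g ∈ multAlgebra k 𝔭 ∧ ∃ (e : ℕ) (a : Fin (n + 1) → k), g = addForm k p e a},
      constantCoeff g = 0 := by
    rintro g ⟨-, e, a, rfl⟩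
    exact constantCoeff_addForm_eq_zero k p e a
  have hmem := sub_C_constantCoeff_mem_ideal_span_of_mem_adjoin hG hfU'
  rw [show constantCoeff f = 0 from hf0, C_0, sub_zero] at hmem
  rw [SetLike.mem_coe]
  refine (Ideal.span_le.mpr ?_) hmem
  rintro g ⟨hgU, e, a, rfl⟩
  rw [SetLike.mem_coe]
  unfold famIdeal
  exact Ideal.subset_span (Set.mem_iUnion.mpr ⟨e, a, (addForm_mem_multAlgebra_iff k p 𝔭).mp hgU, rfl⟩)

/-- **MIZUTANI'S THEOREM 1.3 on Hironaka's side**: `dim B_{P,𝔭} = ringKrullDim (S ⧸ U_+(𝔭)S) = (n+1) − dim_k (U(𝔭) ∩ L)_{e₀}`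
for every level `e₀` from which on `U(𝔭) ∩ L` is generated (`exists_eventually_eq_span_hirForms`), conditional on
Hironaka's generation theorem `Hironaka1970_thm1_cor` only.
[cite: Mizutani1973HironakaGroupSchemes, Thm. 1.3 ("dim(Spec(S/N S)) = dim_k(L_e/N_e)")] -/
theorem ringKrullDim_quotient_bIdeal (hH : Hironaka1970_thm1_cor.{u} p) (hP : IsPoint k 𝔭) [𝔭.IsPrime] {e₀ : ℕ}
    (hE : ∀ j, e₀ ≤ j → hirForms k p 𝔭 j ≤
      Submodule.span k (frobVec k p (j - e₀) '' (hirForms k p 𝔭 e₀ : Set (Fin (n + 1) → k)))) :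
    ringKrullDim (MvPolynomial (Fin (n + 1)) k ⧸ bIdeal k 𝔭) =
      ((n + 1 - Module.finrank k (hirForms k p 𝔭 e₀) : ℕ) : WithBot ℕ∞) := by
  rw [bIdeal_eq_famIdeal_hirForms k p 𝔭 hH hP]
  exact ringKrullDim_quotient_famIdeal_hirForms k p 𝔭 hE

/-- **The two vocabularies' dimensions agree**: under Hironaka's generation theorem and Oda's equality
`U(𝔭) ∩ L_e = (L_B)_e` for all `e` (Oda 1973 Prop. 2.2 (ii); its `⊆` half is the tree's `hirForms_le_invForms`),
`dim B_{P,𝔭} = ringKrullDim (S ⧸ U_+(𝔭)S) = hsDim k p 𝔭` (Oda's rank formula read at the exponent).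
[cite: Mizutani1973HironakaGroupSchemes, Thm. 1.3; Oda1983HironakaGroupSchemeII, §2 (p. 1168)] -/
theorem ringKrullDim_quotient_bIdeal_eq_hsDim [𝔭.IsPrime] (hH : Hironaka1970_thm1_cor.{u} p)
    (hOda : ∀ e, hirForms k p 𝔭 e = invForms k p 𝔭 e) (hP : IsPoint k 𝔭) :
    ringKrullDim (MvPolynomial (Fin (n + 1)) k ⧸ bIdeal k 𝔭) = (hsDim k p 𝔭 : WithBot ℕ∞) := by
  have hfun : hirForms k p 𝔭 = invForms k p 𝔭 := funext hOda
  rw [bIdeal_eq_famIdeal_hirForms k p 𝔭 hH hP, hfun]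
  exact ringKrullDim_quotient_schemeIdeal k p 𝔭

/-- **Mizutani's lower bound for `dim B_{P,𝔭}` in Hironaka's multiplicity vocabulary** (under the same two cited
theorems): `2·p^{exponent B(𝔭)} ≤ dim B_{P,𝔭} + 1` for every point `𝔭` of `ℙ^n_k`.
[cite: Mizutani1973HironakaGroupSchemes, Remark 2.10] -/
theorem two_mul_pow_exponent_le_ringKrullDim_bIdeal_succ [𝔭.IsPrime] (hH : Hironaka1970_thm1_cor.{u} p)
    (hOda : ∀ e, hirForms k p 𝔭 e = invForms k p 𝔭 e) (hP : IsPoint k 𝔭) :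
    (2 * p ^ exponent k p 𝔭 : WithBot ℕ∞) ≤ ringKrullDim (MvPolynomial (Fin (n + 1)) k ⧸ bIdeal k 𝔭) + 1 := by
  rw [ringKrullDim_quotient_bIdeal_eq_hsDim k p 𝔭 hH hOda hP, ← ringKrullDim_quotient_schemeIdeal]
  exact two_mul_pow_exponent_le_ringKrullDim_succ k p 𝔭 hP

end Hironaka

end Summit.ResolutionOfSingularities.KangarooAtlas.Mizutani
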